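import Literature.Probability.RandomPlanarGeometry.SLESixLocalityOfBounded
import Literature.Probability.RandomPlanarGeometry.SLESixHullLocalityReductionNbhd
import HarnessLib

/-!
# The restriction form of the locality of chordal SLE₆ from the neighbourhood half-plane form

Topic `Probability/RandomPlanarGeometry`; one theorem (crux `stmt-CriticalPhenomena-0698`, stub
`stub_isLocal`). Composition of the two reductions of this line: the typed restriction form
`IsSLELaw.locality_six` (`SLESixLocality.lean`; all Dobrushin subdomains with the same marked points,
curves stopped at the first time the CURVE meets `closure (D ∖ D')`) follows from its hull-subdomain
clause (`IsSLELaw.locality_six_of_bounded`, `SLESixLocalityOfBounded.lean`: buried targets handled by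
re-targeting at free boundary points, shrinking stopping sets and Newman's cross-cut order lemma),
which follows from the neighbourhood curve-hitting half-plane form
(`IsSLELaw.locality_six_bounded_of_hull_nbhd`, `SLESixHullLocalityReductionNbhd.lean`). The alive
half-plane form is a theorem (`sle_six_hull_locality_alive_holds`); the remaining input is therefore
exactly the passage through the (finitely many) swallowing instants, `sle_six_hull_locality_nbhd`.
-/

noncomputable section

namespace Literature.Probability.RandomPlanarGeometry

/-- **`IsSLELaw.locality_six` from the neighbourhood half-plane form of the locality of SLE₆.**
[cite: LawlerSchrammWerner2001, Thm 2.2 and Cor 2.4] -/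
theorem IsSLELaw.locality_six_of_hull_nbhd (h : sle_six_hull_locality_nbhd) : IsSLELaw.locality_six :=
  IsSLELaw.locality_six_of_bounded (IsSLELaw.locality_six_bounded_of_hull_nbhd h)

/-- **A family of chordal SLE₆ laws is local, given the neighbourhood half-plane form.**
[cite: LawlerSchrammWerner2001, Cor 2.4] -/
theorem ChordalFamily.isLocal_of_isSLELaw_six_of_hull_nbhd (h : sle_six_hull_locality_nbhd)
    {Q : ChordalFamily} (hQ : ∀ D : DobrushinDomain, IsSLELaw 6 D (Q D)) : Q.IsLocal :=
  ChordalFamily.isLocal_of_isSLELaw_six (IsSLELaw.locality_six_of_hull_nbhd h) hQ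

end Literature.Probability.RandomPlanarGeometry

end
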